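import Mathlib
import Summits.Ventures.PercRepro2.Defs
import Summits.Ventures.PercRepro2.Graph
import Summits.Ventures.PercRepro2.Events
import Summits.Ventures.PercRepro2.CycleDefs
import Summits.Ventures.PercRepro2.CycleTerm
import Summits.Ventures.PercRepro2.CycleDecode
import Summits.Ventures.PercRepro2.CycleCore
import Summits.Ventures.PercRepro2.AntipodalKleitman

/-!
# Every antipodal base case of a cycle is nonnegative (blind cell PercRepro2, mine-a g47)

The antipodal base cases of the lane's three-event inequality (T_h) on a cycle (`TReduction`,
`TReductionBase`) are sums over the red sets `τ ⊆ D` of the antipodal edges, the edges of a fixed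
set `F` (disjoint from `D`) being closed in both copies:

  `wtF τ = 1[h ∈ arc (τ ∪ F)] · (1[arc (τ ∪ F) ∈ 𝓤] − 1[arc ((D∖τ) ∪ F) ∈ 𝓤]) · (same for 𝓥)`.

**Theorem `sum_wtF_nonneg`**: `Σ_{τ ⊆ D} wtF τ ≥ 0` for up-sets `𝓤 𝓥`.  Four cases
(MINE-A.md §102.2, proofs/MINEA-CYCLE.md): no pinned-closed edge and `h` strictly inside the hull of
`D` — the counting core `CycleCore.sum_wt_nonneg`; no pinned-closed edge and `h` outside the hull —
every arc contains `h` and the sum is the antipodal Harris form (`AntipodalKleitman` with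
`G = G' = ∅`); pinned-closed edges on both sides of `h` — no arc contains `h`, the sum is `0`;
pinned-closed edges on one side of `h` only — the hit weight forces every red edge to that side,
and the sum is the comparable antipodal form over the antipodal edges of that side, the second copy
pinned closed on the other side as well (`AntipodalKleitman.antipodal_comparable_nonneg`).
No instance, no notation.
-/

namespace Summit.Ventures.PercRepro2

namespace TCycle

open Finset

variable {n : ℕ}

open Classical in
/-- The term of the antipodal sum at the red set `τ ⊆ D` when the edges of `F` are closed in both
copies. -/
noncomputable def wtF (D F : Finset (Fin (n + 1))) (h : Fin (n + 1))
    (𝓤 𝓥 : Set (Set (Fin (n + 1)))) (τ : Finset (Fin (n + 1))) : ℤ :=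
  (if h ∈ arc (τ ∪ F) then 1 else 0)
    * ((if arc (τ ∪ F) ∈ 𝓤 then 1 else 0) - (if arc ((D \ τ) ∪ F) ∈ 𝓤 then 1 else 0))
    * ((if arc (τ ∪ F) ∈ 𝓥 then 1 else 0) - (if arc ((D \ τ) ∪ F) ∈ 𝓥 then 1 else 0))

/-- Without pinned-closed edges the term is `wt`. -/
lemma wtF_empty (D : Finset (Fin (n + 1))) (h : Fin (n + 1)) (𝓤 𝓥 : Set (Set (Fin (n + 1))))
    (τ : Finset (Fin (n + 1))) : wtF D ∅ h 𝓤 𝓥 τ = wt D h 𝓤 𝓥 τ := by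
  unfold wtF wt
  have h1 : τ ∪ ∅ = τ := Finset.union_empty τ
  have h2 : D \ τ ∪ ∅ = D \ τ := Finset.union_empty _
  rw [h1, h2]

open Classical in
/-- The indicator of membership of an arc in a family, as a function of the closed set. -/
noncomputable def arcInd (𝓤 : Set (Set (Fin (n + 1)))) (Z : Finset (Fin (n + 1))) : ℤ :=
  if arc Z ∈ 𝓤 then 1 else 0

/-- `arcInd` is `{0,1}`-valued. -/
lemma arcInd_zero_one (𝓤 : Set (Set (Fin (n + 1)))) (Z : Finset (Fin (n + 1))) :
    arcInd 𝓤 Z = 0 ∨ arcInd 𝓤 Z = 1 := by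
  unfold arcInd; split_ifs <;> simp

/-- `arcInd` of an up-set is antitone in the closed set. -/
lemma arcInd_antitone {𝓤 : Set (Set (Fin (n + 1)))} (hU : IsUpperSet 𝓤) : Antitone (arcInd 𝓤) := by
  intro Z Z' hle
  unfold arcInd
  by_cases h1 : arc Z' ∈ 𝓤
  · have h2 : arc Z ∈ 𝓤 := hU (arc_anti hle) h1
    simp [h1, h2]
  · simp [h1]
    split_ifs <;> norm_num

/-- The term when `h` lies in the red arc, through `arcInd`. -/
lemma wtF_of_mem {D F : Finset (Fin (n + 1))} {h : Fin (n + 1)} {𝓤 𝓥 : Set (Set (Fin (n + 1)))}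
    {τ : Finset (Fin (n + 1))} (hh : h ∈ arc (τ ∪ F)) :
    wtF D F h 𝓤 𝓥 τ = (arcInd 𝓤 (τ ∪ F) - arcInd 𝓤 ((D \ τ) ∪ F))
      * (arcInd 𝓥 (τ ∪ F) - arcInd 𝓥 ((D \ τ) ∪ F)) := by
  unfold wtF arcInd
  simp [hh]

/-- The term when `h` is not in the red arc is `0`. -/
lemma wtF_of_notMem {D F : Finset (Fin (n + 1))} {h : Fin (n + 1)} {𝓤 𝓥 : Set (Set (Fin (n + 1)))}
    {τ : Finset (Fin (n + 1))} (hh : h ∉ arc (τ ∪ F)) : wtF D F h 𝓤 𝓥 τ = 0 := by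
  unfold wtF
  simp [hh]

section Cases

variable {D F : Finset (Fin (n + 1))} {h : Fin (n + 1)} {𝓤 𝓥 : Set (Set (Fin (n + 1)))}

/-- **No pinned-closed edge, `h` outside the hull of `D`**: every arc contains `h` and the sum is
the antipodal Harris form. -/
lemma sum_wtF_nonneg_of_mem_arc (hU : IsUpperSet 𝓤) (hV : IsUpperSet 𝓥) (hh : h ∈ arc D) :
    0 ≤ ∑ τ ∈ D.powerset, wtF D ∅ h 𝓤 𝓥 τ := by
  have hsum : ∀ τ ∈ D.powerset, wtF D ∅ h 𝓤 𝓥 τ =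
      (arcInd 𝓤 (τ ∪ ∅) - arcInd 𝓤 ((D \ τ) ∪ ∅)) *
        (arcInd 𝓥 (τ ∪ ∅) - arcInd 𝓥 ((D \ τ) ∪ ∅)) := by
    intro τ hτ
    rw [mem_powerset] at hτ
    exact wtF_of_mem (by rw [Finset.union_empty]; exact arc_anti hτ hh)
  rw [sum_congr rfl hsum]
  exact AntipodalKleitman.antipodal_comparable_nonneg D ∅ ∅ (arcInd 𝓤) (arcInd 𝓥) (le_refl _)
    (arcInd_zero_one 𝓤) (arcInd_antitone hU) (arcInd_zero_one 𝓥) (arcInd_antitone hV)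

/-- **No pinned-closed edge**: the base case is nonnegative. -/
lemma sum_wtF_nonneg_empty (hU : IsUpperSet 𝓤) (hV : IsUpperSet 𝓥) :
    0 ≤ ∑ τ ∈ D.powerset, wtF D ∅ h 𝓤 𝓥 τ := by
  by_cases hD : D.Nonempty
  · by_cases hh : D.min' hD < h ∧ h ≤ D.max' hD
    · rw [sum_congr rfl fun τ _ => wtF_empty D h 𝓤 𝓥 τ]
      exact sum_wt_nonneg hD hU hV hh.1 hh.2
    · apply sum_wtF_nonneg_of_mem_arc hU hV
      rw [arc_eq_min_max hD]
      by_cases h1 : D.min' hD < h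
      · exact Or.inr (lt_of_not_ge fun h2 => hh ⟨h1, h2⟩)
      · exact Or.inl (not_lt.1 h1)
  · rw [not_nonempty_iff_eq_empty] at hD
    subst hD
    apply sum_wtF_nonneg_of_mem_arc hU hV
    simp

/-- **Pinned-closed edges on both sides of `h`**: no arc contains `h`, the sum vanishes. -/
lemma sum_wtF_eq_zero_of_both (hx : ∃ x ∈ F, x < h) (hy : ∃ y ∈ F, h ≤ y) :
    ∑ τ ∈ D.powerset, wtF D F h 𝓤 𝓥 τ = 0 := by
  refine sum_eq_zero fun τ _ => wtF_of_notMem ?_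
  obtain ⟨x, hxF, hxh⟩ := hx
  obtain ⟨y, hyF, hyh⟩ := hy
  rintro (hc | hc)
  · exact absurd (hc x (mem_union_right _ hxF)) (not_le.2 hxh)
  · exact absurd (hc y (mem_union_right _ hyF)) (not_lt.2 hyh)

/-- The part of `D` below `h`. -/
def lowPart (D : Finset (Fin (n + 1))) (h : Fin (n + 1)) : Finset (Fin (n + 1)) :=
  D.filter fun x => x < h

/-- The part of `D` from `h` on. -/
def highPart (D : Finset (Fin (n + 1))) (h : Fin (n + 1)) : Finset (Fin (n + 1)) :=
  D.filter fun x => h ≤ x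

/-- The subsets of `D` contained in the low part are the subsets of the low part. -/
lemma powerset_filter_subset_lowPart :
    D.powerset.filter (fun τ => τ ⊆ lowPart D h) = (lowPart D h).powerset := by
  ext τ
  simp only [mem_filter, mem_powerset]
  constructor
  · rintro ⟨_, h2⟩; exact h2
  · intro h1; exact ⟨le_trans h1 (filter_subset _ _), h1⟩

/-- The subsets of `D` contained in the high part are the subsets of the high part. -/
lemma powerset_filter_subset_highPart :
    D.powerset.filter (fun τ => τ ⊆ highPart D h) = (highPart D h).powerset := by
  ext τ
  simp only [mem_filter, mem_powerset]
  constructor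
  · rintro ⟨_, h2⟩; exact h2
  · intro h1; exact ⟨le_trans h1 (filter_subset _ _), h1⟩

/-- For `τ ⊆ lowPart D h`, `D ∖ τ = (lowPart D h ∖ τ) ∪ highPart D h`. -/
lemma sdiff_eq_of_subset_lowPart {τ : Finset (Fin (n + 1))} (hτ : τ ⊆ lowPart D h) :
    D \ τ = (lowPart D h \ τ) ∪ highPart D h := by
  ext x
  simp only [mem_sdiff, mem_union, lowPart, highPart, mem_filter]
  constructor
  · rintro ⟨hxD, hxτ⟩
    by_cases hxh : x < h
    · exact Or.inl ⟨⟨hxD, hxh⟩, hxτ⟩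
    · exact Or.inr ⟨hxD, not_lt.1 hxh⟩
  · rintro (⟨⟨hxD, _⟩, hxτ⟩ | ⟨hxD, hxh⟩)
    · exact ⟨hxD, hxτ⟩
    · refine ⟨hxD, fun hxτ => ?_⟩
      have := (mem_filter.1 (hτ hxτ)).2
      exact absurd hxh (not_le.2 this)

/-- For `τ ⊆ highPart D h`, `D ∖ τ = (highPart D h ∖ τ) ∪ lowPart D h`. -/
lemma sdiff_eq_of_subset_highPart {τ : Finset (Fin (n + 1))} (hτ : τ ⊆ highPart D h) :
    D \ τ = (highPart D h \ τ) ∪ lowPart D h := by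
  ext x
  simp only [mem_sdiff, mem_union, lowPart, highPart, mem_filter]
  constructor
  · rintro ⟨hxD, hxτ⟩
    by_cases hxh : h ≤ x
    · exact Or.inl ⟨⟨hxD, hxh⟩, hxτ⟩
    · exact Or.inr ⟨hxD, not_le.1 hxh⟩
  · rintro (⟨⟨hxD, _⟩, hxτ⟩ | ⟨hxD, hxh⟩)
    · exact ⟨hxD, hxτ⟩
    · refine ⟨hxD, fun hxτ => ?_⟩
      have := (mem_filter.1 (hτ hxτ)).2
      exact absurd hxh (not_lt.2 this)

/-- **Pinned-closed edges below `h` only**: the hit weight forces the red edges below `h` and the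
sum is the comparable antipodal form over the low part. -/
lemma sum_wtF_nonneg_of_low (hU : IsUpperSet 𝓤) (hV : IsUpperSet 𝓥) (hF : F.Nonempty)
    (hlow : ∀ x ∈ F, x < h) : 0 ≤ ∑ τ ∈ D.powerset, wtF D F h 𝓤 𝓥 τ := by
  obtain ⟨x₀, hx₀⟩ := hF
  -- the hit weight is the indicator of `τ ⊆ lowPart D h`
  have hhit : ∀ τ ∈ D.powerset, h ∈ arc (τ ∪ F) ↔ τ ⊆ lowPart D h := by
    intro τ hτ
    rw [mem_powerset] at hτ
    constructor
    · rintro (hc | hc)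
      · exact absurd (hc x₀ (mem_union_right _ hx₀)) (not_le.2 (hlow x₀ hx₀))
      · intro i hi
        exact mem_filter.2 ⟨hτ hi, hc i (mem_union_left _ hi)⟩
    · intro hsub
      refine Or.inr fun i hi => ?_
      rcases mem_union.1 hi with hi | hi
      · exact (mem_filter.1 (hsub hi)).2
      · exact hlow i hi
  have hsum : ∑ τ ∈ D.powerset, wtF D F h 𝓤 𝓥 τ =
      ∑ τ ∈ (lowPart D h).powerset,
        (arcInd 𝓤 (τ ∪ F) - arcInd 𝓤 ((lowPart D h \ τ) ∪ (highPart D h ∪ F))) *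
          (arcInd 𝓥 (τ ∪ F) - arcInd 𝓥 ((lowPart D h \ τ) ∪ (highPart D h ∪ F))) := by
    rw [← powerset_filter_subset_lowPart, sum_filter]
    refine sum_congr rfl fun τ hτ => ?_
    by_cases hsub : τ ⊆ lowPart D h
    · rw [if_pos hsub, wtF_of_mem ((hhit τ hτ).2 hsub), sdiff_eq_of_subset_lowPart hsub,
        union_assoc]
    · rw [if_neg hsub, wtF_of_notMem fun hc => hsub ((hhit τ hτ).1 hc)]
  rw [hsum]
  exact AntipodalKleitman.antipodal_comparable_nonneg (lowPart D h) F (highPart D h ∪ F)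
    (arcInd 𝓤) (arcInd 𝓥) subset_union_right (arcInd_zero_one 𝓤) (arcInd_antitone hU)
    (arcInd_zero_one 𝓥) (arcInd_antitone hV)

/-- **Pinned-closed edges from `h` on only**: the mirror case. -/
lemma sum_wtF_nonneg_of_high (hU : IsUpperSet 𝓤) (hV : IsUpperSet 𝓥) (hF : F.Nonempty)
    (hhigh : ∀ x ∈ F, h ≤ x) : 0 ≤ ∑ τ ∈ D.powerset, wtF D F h 𝓤 𝓥 τ := by
  obtain ⟨x₀, hx₀⟩ := hF
  have hhit : ∀ τ ∈ D.powerset, h ∈ arc (τ ∪ F) ↔ τ ⊆ highPart D h := by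
    intro τ hτ
    rw [mem_powerset] at hτ
    constructor
    · rintro (hc | hc)
      · intro i hi
        exact mem_filter.2 ⟨hτ hi, hc i (mem_union_left _ hi)⟩
      · exact absurd (hc x₀ (mem_union_right _ hx₀)) (not_lt.2 (hhigh x₀ hx₀))
    · intro hsub
      refine Or.inl fun i hi => ?_
      rcases mem_union.1 hi with hi | hi
      · exact (mem_filter.1 (hsub hi)).2
      · exact hhigh i hi
  have hsum : ∑ τ ∈ D.powerset, wtF D F h 𝓤 𝓥 τ =
      ∑ τ ∈ (highPart D h).powerset,
        (arcInd 𝓤 (τ ∪ F) - arcInd 𝓤 ((highPart D h \ τ) ∪ (lowPart D h ∪ F))) *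
          (arcInd 𝓥 (τ ∪ F) - arcInd 𝓥 ((highPart D h \ τ) ∪ (lowPart D h ∪ F))) := by
    rw [← powerset_filter_subset_highPart, sum_filter]
    refine sum_congr rfl fun τ hτ => ?_
    by_cases hsub : τ ⊆ highPart D h
    · rw [if_pos hsub, wtF_of_mem ((hhit τ hτ).2 hsub), sdiff_eq_of_subset_highPart hsub,
        union_assoc]
    · rw [if_neg hsub, wtF_of_notMem fun hc => hsub ((hhit τ hτ).1 hc)]
  rw [hsum]
  exact AntipodalKleitman.antipodal_comparable_nonneg (highPart D h) F (lowPart D h ∪ F)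
    (arcInd 𝓤) (arcInd 𝓥) subset_union_right (arcInd_zero_one 𝓤) (arcInd_antitone hU)
    (arcInd_zero_one 𝓥) (arcInd_antitone hV)

/-- **Every antipodal base case of a cycle is nonnegative.** -/
theorem sum_wtF_nonneg (hU : IsUpperSet 𝓤) (hV : IsUpperSet 𝓥) :
    0 ≤ ∑ τ ∈ D.powerset, wtF D F h 𝓤 𝓥 τ := by
  by_cases hF : F.Nonempty
  · by_cases hlow : ∀ x ∈ F, x < h
    · exact sum_wtF_nonneg_of_low hU hV hF hlow
    · by_cases hhigh : ∀ x ∈ F, h ≤ x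
      · exact sum_wtF_nonneg_of_high hU hV hF hhigh
      · push Not at hlow hhigh
        rw [sum_wtF_eq_zero_of_both hhigh hlow]
  · rw [not_nonempty_iff_eq_empty] at hF
    subst hF
    exact sum_wtF_nonneg_empty hU hV

end Cases

end TCycle

end Summit.Ventures.PercRepro2
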